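import Summits.CriticalPhenomena.PercolationContinuityZ3.Theorems.PercNearOneGluingNoHeavyLowerTailSahiCTCLadderPrep
import Summits.CriticalPhenomena.PercolationContinuityZ3.Theorems.PercNearOneGluingNoHeavyLowerTailSahiCTCKleitmanDensityT
import HarnessLib

/-!
# `NoHeavyLowerTail` (crux stmt-CriticalPhenomena-4575), P3 lane: the SQUAREFREE part of the ladder inequality `(L_t)` at EVERY level `t`

Support file (seat `prim-l12-p3`, gen 26; `--supports stmt-CriticalPhenomena-4575`).  The ladder conjecture (memo g24 §5.5) at level `t` reads
`L_t(𝒳,𝒵) := e_t·(Π·GF(𝒳∩𝒵) − GF(𝒳)·GF(𝒵)) − Θ_{t−1}·e_{≥t}·GF((𝒳∩𝒵)_t) ∈ ℕ[s]` for every pair of `t`-live up-sets (`Θ_{t−1}` = sets of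
size `≤ t−1`, `e_{≥t}` = sets of size `≥ t`, `(𝒳∩𝒵)_t` = common `t`-sets); `t = 2` is `…SahiCTCLadderTwo.coeff_ladder_two_nonneg`.
Here, for every `t ≥ 1` and every finset `T`, the coefficient of the SQUAREFREE monomial `s^T` is shown nonnegative (memo g25 §6, g26 §1):
* `coeff_ind_ee_mul` (`[s^T](e_t·P) = Σ_{E ⊆ T, #E = t} [s^{T∖E}] P`), `coeff_ind_harris_eq_kap` (`[s^T] H = κ(∅,T)`);
* `coeff_ind_theta_mul_atLeast` (`[s^F](Θ_{t−1}·e_{≥t}) = cH t #F`), `coeff_ind_charge` (the charge at `s^T` is `cH t (#T−t)·#W[T]`);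
* `sum_card_csetsT_sdiff` (each common `t`-set inside `T` survives in `C(#T−t,t)` of the restrictions `T ∖ E`);
* `coeff_ladder_sqfree_nonneg` — **`[s^T] L_t(𝒳,𝒵) ≥ 0`** for all `t`-live up-sets, every `t ≥ 1`, every `T` (t-DENSITY on each `T ∖ E`).
Nothing is asserted about the crux.
-/

namespace Summit.CriticalPhenomena.PercolationContinuityZ3.Theorems.SahiCTCForms

open Finset MvPolynomial SahiCTCGenFun SahiCTCWeightedLYM

variable {α : Type*} [DecidableEq α] [Fintype α]

section Sqfree
variable {𝒳 𝒵 : Finset (Finset α)}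

omit [Fintype α] in
/-- The support of `1_T` is `T`. [this work] -/
theorem ind_support_eq (T : Finset α) : (ind T).support = T := by
  ext i; simp [Finsupp.mem_support_iff, ind_apply]

omit [Fintype α] in
/-- `1_T ≤ 1` pointwise (hence `≤ 2`). [this work] -/
theorem ind_apply_le_two (T : Finset α) (i : α) : ind T i ≤ 2 := by
  rw [ind_apply]; split_ifs <;> omega

omit [Fintype α] in
/-- A squarefree profile has no doubled points. [this work] -/
theorem dbl_ind (T : Finset α) : dbl (ind T) = ∅ := by
  unfold dbl
  refine filter_eq_empty_iff.2 fun i _ h => ?_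
  by_cases hi : i ∈ T <;> simp [ind_apply, hi] at h

omit [Fintype α] in
/-- The single points of a squarefree profile are its support. [this work] -/
theorem sgl_ind (T : Finset α) : sgl (ind T) = T := by
  unfold sgl; rw [dbl_ind, sdiff_empty, ind_support_eq]

omit [Fintype α] in
/-- `1_E ≤ 1_T ↔ E ⊆ T`. [this work] -/
theorem ind_le_ind_iff {E T : Finset α} : ind E ≤ ind T ↔ E ⊆ T := by
  rw [SahiAllButC.ind_le_iff_subset_support, ind_support_eq]

omit [Fintype α] in
/-- `1_T − 1_E = 1_{T∖E}` for `E ⊆ T`. [this work] -/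
theorem ind_sub_ind {E T : Finset α} (h : E ⊆ T) : ind T - ind E = ind (T \ E) := by
  ext i
  simp only [SahiAllButC.tsub_ind_apply, ind_apply, mem_sdiff]
  by_cases hT : i ∈ T
  · by_cases hE : i ∈ E
    · simp [hT, hE]
    · simp [hT, hE]
  · have hE : i ∉ E := fun hE => hT (h hE)
    simp [hT, hE]

/-- **Squarefree coefficient of `e_t·P`**: `[s^T](e_t·P) = Σ_{E ⊆ T, #E = t} [s^{T∖E}] P`. [this work] -/
theorem coeff_ind_ee_mul (t : ℕ) (P : MvPolynomial α ℤ) (T : Finset α) :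
    (ee t * P).coeff (ind T) = ∑ E ∈ T.powersetCard t, P.coeff (ind (T \ E)) := by
  unfold ee
  rw [coeff_gf_mul]
  have hidx : ((bySize (· = t) : Finset (Finset α)).filter fun E => ind E ≤ ind T) = T.powersetCard t := by
    ext E; simp only [bySize, mem_filter, mem_powerset, subset_univ, true_and, ind_le_ind_iff, mem_powersetCard]; tauto
  rw [hidx]
  exact sum_congr rfl fun E hE => by rw [ind_sub_ind (mem_powersetCard.1 hE).1]

/-- **Squarefree coefficient of the Harris form** `= κ(∅, T)`. [this work] -/
theorem coeff_ind_harris_eq_kap (𝒳 𝒵 : Finset (Finset α)) (T : Finset α) :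
    (PiP * gf (𝒳 ∩ 𝒵) - gf 𝒳 * gf 𝒵).coeff (ind T) = kap 𝒳 𝒵 ∅ T := by
  rw [coeff_harrisForm_eq_kap _ _ (ind_apply_le_two T), dbl_ind, sgl_ind]

/-- The trace of `bySize p` on `(∅, F)` is `{U ⊆ F : p #U}`. [this work] -/
theorem tr_bySize_empty (p : ℕ → Prop) [DecidablePred p] (F : Finset α) :
    tr (bySize p : Finset (Finset α)) ∅ F = F.powerset.filter fun U => p #U := by
  ext U; simp only [mem_tr_empty, bySize, mem_filter, mem_powerset, subset_univ, true_and]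

omit [Fintype α] in
/-- Counting: `#{U ⊆ F : #U ≤ t−1, t ≤ #(F∖U)} = cH t #F` (for `t ≥ 1`). [this work] -/
theorem card_filter_small_cosmall (t : ℕ) (ht : 1 ≤ t) (F : Finset α) :
    #(F.powerset.filter fun U => #U ≤ t - 1 ∧ t ≤ #(F \ U)) = cH t #F := by
  unfold cH
  have heq : (F.powerset.filter fun U => #U ≤ t - 1 ∧ t ≤ #(F \ U)) =
      (range (min t (#F + 1 - t))).biUnion fun j => F.powersetCard j := by
    ext U
    simp only [mem_filter, mem_powerset, mem_biUnion, mem_range, mem_powersetCard]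
    constructor
    · rintro ⟨hUF, h1, h2⟩
      rw [card_sdiff_of_subset hUF] at h2
      exact ⟨#U, by omega, hUF, rfl⟩
    · rintro ⟨j, hj, hUF, hUj⟩
      rw [card_sdiff_of_subset hUF]
      have := card_le_card hUF
      exact ⟨hUF, by omega, by omega⟩
  rw [heq, card_biUnion]
  · exact sum_congr rfl fun j _ => card_powersetCard j F
  · intro j _ j' _ hjj'
    exact disjoint_left.2 fun U h1 h2 => hjj' ((mem_powersetCard.1 h1).2.symm.trans (mem_powersetCard.1 h2).2)

/-- **`[s^F](Θ_{t−1}·e_{≥t}) = cH t #F`** (`t ≥ 1`). [this work] -/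
theorem coeff_ind_theta_mul_atLeast (t : ℕ) (ht : 1 ≤ t) (F : Finset α) :
    (gf (bySize (· ≤ t - 1) : Finset (Finset α)) * gf (bySize (t ≤ ·) : Finset (Finset α))).coeff (ind F) = cH t #F := by
  rw [coeff_gf_mul_gf_eq_card_tr _ _ (ind_apply_le_two F), dbl_ind, sgl_ind, tr_bySize_empty, tr_bySize_empty,
    ← card_filter_small_cosmall t ht F]
  norm_cast
  congr 1
  ext U; simp only [mem_filter, mem_powerset, sdiff_subset, true_and, and_assoc]

/-- **The charge at a squarefree monomial**: for a family `W` of `t`-sets, `[s^T](Θ_{t−1}·e_{≥t}·GF(W)) = cH t (#T − t) · #{w ∈ W : w ⊆ T}`. [this work] -/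
theorem coeff_ind_charge (t : ℕ) (ht : 1 ≤ t) (W : Finset (Finset α)) (hW : ∀ w ∈ W, #w = t) (T : Finset α) :
    (gf (bySize (· ≤ t - 1) : Finset (Finset α)) * gf (bySize (t ≤ ·) : Finset (Finset α)) * gf W).coeff (ind T) =
      cH t (#T - t) * #(W.filter fun w => w ⊆ T) := by
  rw [mul_comm, coeff_gf_mul]
  have hidx : (W.filter fun w => ind w ≤ ind T) = W.filter fun w => w ⊆ T := by
    ext w; simp only [mem_filter, ind_le_ind_iff]
  rw [hidx]
  have : ∀ w ∈ W.filter (fun w => w ⊆ T), (gf (bySize (· ≤ t - 1) : Finset (Finset α)) *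
      gf (bySize (t ≤ ·) : Finset (Finset α))).coeff (ind T - ind w) = cH t (#T - t) := fun w hw => by
    obtain ⟨hwW, hwT⟩ := mem_filter.1 hw
    rw [ind_sub_ind hwT, coeff_ind_theta_mul_atLeast t ht, card_sdiff_of_subset hwT, hW w hwW]
  rw [sum_congr rfl this, sum_const, nsmul_eq_mul]; ring

omit [Fintype α] in
/-- The common `t`-sets inside `T` (base `∅`) are the common `t`-sets of the pair that lie in `T`. [this work] -/
theorem csetsT_empty_eq (T : Finset α) (t : ℕ) :
    csetsT 𝒳 𝒵 ∅ T t = ((𝒳 ∩ 𝒵).filter fun S => #S = t).filter fun w => w ⊆ T := by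
  ext w; simp only [mem_csetsT, empty_union, mem_filter, mem_inter]; tauto

omit [Fintype α] in
/-- **Double counting**: each common `t`-set inside `T` lies in exactly `C(#T − t, t)` of the restrictions `T ∖ E`, `#E = t`:
`Σ_{E ⊆ T, #E = t} #W[T∖E] = #W[T] · C(#T−t, t)`. [this work] -/
theorem sum_card_csetsT_sdiff (T : Finset α) (t : ℕ) :
    ∑ E ∈ T.powersetCard t, #(csetsT 𝒳 𝒵 ∅ (T \ E) t) = #(csetsT 𝒳 𝒵 ∅ T t) * (#T - t).choose t := by
  have h1 : ∀ E ∈ T.powersetCard t, #(csetsT 𝒳 𝒵 ∅ (T \ E) t) = ∑ w ∈ csetsT 𝒳 𝒵 ∅ T t, if Disjoint w E then 1 else 0 :=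
    fun E hE => by
    rw [← card_filter]
    congr 1; ext w
    simp only [mem_csetsT, mem_filter, subset_sdiff]; tauto
  rw [sum_congr rfl h1, sum_comm]
  have h2 : ∀ w ∈ csetsT 𝒳 𝒵 ∅ T t, (∑ E ∈ T.powersetCard t, if Disjoint w E then 1 else 0) = (#T - t).choose t := fun w hw => by
    obtain ⟨hwT, hwt, _⟩ := mem_csetsT.1 hw
    rw [← card_filter]
    have : ((T.powersetCard t).filter fun E => Disjoint w E) = (T \ w).powersetCard t := by
      ext E; simp only [mem_filter, mem_powersetCard, subset_sdiff, disjoint_comm]; tauto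
    rw [this, card_powersetCard, card_sdiff_of_subset hwT, hwt]
  rw [sum_congr rfl h2, sum_const, smul_eq_mul]

/-- **The squarefree part of the ladder inequality `(L_t)`, every level `t ≥ 1`**: for `t`-live up-sets `𝒳, 𝒵` and every finset `T`,
`[s^T] ( e_t·(Π·GF(𝒳∩𝒵) − GF(𝒳)GF(𝒵)) − Θ_{t−1}·e_{≥t}·GF((𝒳∩𝒵)_t) ) ≥ 0`.  Proof: the left part is `Σ_{E ⊆ T, #E=t} κ(∅, T∖E)`, the
charge is `cH t (#T−t)·#W[T]`, and t-DENSITY on each `T ∖ E` with the double count `Σ_E #W[T∖E] = C(#T−t,t)·#W[T]`. [this work] -/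
theorem coeff_ladder_sqfree_nonneg (h𝒳 : IsUpperSet (𝒳 : Set (Finset α))) (h𝒵 : IsUpperSet (𝒵 : Set (Finset α)))
    {t : ℕ} (ht : 1 ≤ t) (hXt : ∀ S ∈ 𝒳, t ≤ #S) (hZt : ∀ S ∈ 𝒵, t ≤ #S) (T : Finset α) :
    0 ≤ (ee t * (PiP * gf (𝒳 ∩ 𝒵) - gf 𝒳 * gf 𝒵) -
      gf (bySize (· ≤ t - 1) : Finset (Finset α)) * gf (bySize (t ≤ ·) : Finset (Finset α)) *
        gf ((𝒳 ∩ 𝒵).filter fun S => #S = t)).coeff (ind T) := by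
  rw [coeff_sub, sub_nonneg, coeff_ind_charge t ht _ (fun w hw => (mem_filter.1 hw).2), coeff_ind_ee_mul,
    ← csetsT_empty_eq]
  simp_rw [coeff_ind_harris_eq_kap]
  set f := #T - t with hf
  set W := csetsT 𝒳 𝒵 ∅ T t with hW
  -- t-DENSITY on every restriction T \ E (all of size f), summed
  have hdens : ∀ E ∈ T.powersetCard t,
      (cH t f : ℤ) * #(csetsT 𝒳 𝒵 ∅ (T \ E) t) ≤ (f.choose t : ℤ) * kap 𝒳 𝒵 ∅ (T \ E) := fun E hE => by
    have hE := mem_powersetCard.1 hE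
    have hcard : #(T \ E) = f := by rw [card_sdiff_of_subset hE.1, hE.2]
    have := densityT_le_kap_empty h𝒳 h𝒵 hXt hZt (T \ E)
    rwa [hcard] at this
  have hsum := sum_le_sum hdens
  rw [← mul_sum, ← mul_sum] at hsum
  have hcount : ∑ E ∈ T.powersetCard t, (#(csetsT 𝒳 𝒵 ∅ (T \ E) t) : ℤ) = #W * (f.choose t : ℤ) := by
    exact_mod_cast sum_card_csetsT_sdiff (𝒳 := 𝒳) (𝒵 := 𝒵) T t
  rw [hcount] at hsum
  have hk : 0 ≤ ∑ E ∈ T.powersetCard t, kap 𝒳 𝒵 ∅ (T \ E) :=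
    sum_nonneg fun E _ => kap_nonneg h𝒳 h𝒵 _ _ (disjoint_empty_left _)
  by_cases hft : t ≤ f
  · have hpos : (0 : ℤ) < f.choose t := by exact_mod_cast Nat.choose_pos hft
    have : (cH t f : ℤ) * #W * (f.choose t : ℤ) ≤ (∑ E ∈ T.powersetCard t, kap 𝒳 𝒵 ∅ (T \ E)) * (f.choose t : ℤ) := by
      calc (cH t f : ℤ) * #W * (f.choose t : ℤ) = (cH t f : ℤ) * (#W * (f.choose t : ℤ)) := by ring
        _ ≤ (f.choose t : ℤ) * ∑ E ∈ T.powersetCard t, kap 𝒳 𝒵 ∅ (T \ E) := hsum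
        _ = _ := by ring
    exact le_of_mul_le_mul_right this hpos
  · have h0 : cH t f = 0 := by
      unfold cH
      rw [show min t (f + 1 - t) = 0 from by omega, sum_range_zero]
    rw [h0, Nat.cast_zero, zero_mul]; exact hk

end Sqfree

end Summit.CriticalPhenomena.PercolationContinuityZ3.Theorems.SahiCTCForms
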